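import Summits.ValiantsHypothesis.ValiantsHypothesis.Theses.LiouvilleSarnak

/-!
# ValiantsHypothesis / LiouvilleSarnak — item `Assembly` (stmt-ValiantsHypothesis-14781), closed

The assembly item of route `LiouvilleSarnak` is literally the type of the route's deciding theorem
`Theses.LiouvilleSarnak.closes` (LiouvilleNotInVP → LiouvilleInVNP → ValiantsHypothesis); it is proved by `closes` itself. HONEST FRAMING: bookkeeping; the
hypotheses are OPEN cruxes; nothing here is progress on `VP ≠ VNP`.
-/

-- layout Summits/ValiantsHypothesis/ValiantsHypothesis forces the duplicated namespace component
set_option linter.dupNamespace false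

namespace Summit.ValiantsHypothesis.ValiantsHypothesis.Theorems.LiouvilleSarnak

/-- **Item `Assembly` (stmt-ValiantsHypothesis-14781):** LiouvilleNotInVP → LiouvilleInVNP → ValiantsHypothesis — the route's deciding theorem `closes`. [folklore] -/
theorem assembly_proof : Theses.LiouvilleSarnak.Assembly := by
  unfold Theses.LiouvilleSarnak.Assembly
  exact fun hT hN => Theses.LiouvilleSarnak.closes hT hN

end Summit.ValiantsHypothesis.ValiantsHypothesis.Theorems.LiouvilleSarnak
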